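import Summits.AtomisticToContinuum.BoseEinsteinCondensation.Theses.BECLatticeDepthHomotopy

/-!
# Route `BECLatticeDepthHomotopy`, assembly item `Assembly` (stmt-AtomisticToContinuum-12409)

Settles the assembly item `stmt-AtomisticToContinuum-12409` of route
`route-AtomisticToContinuum-BECLatticeDepthHomotopy`: the implication

  `LatticeOnlyDepletes → DeepLatticeFloor → ModeIdentification → SparseToFull →
    BoundaryTransferWeak → BoseEinsteinCondensation`

(the sub-problem statement, by name).

The hypotheses of `Assembly` are, verbatim and in the same order, those of the route's deciding
theorem `closes`; the composition is spelled out again here so that the file depends only on the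
five item definitions. It is pure filter logic: fix a repulsive finite-range `v`; the three
`let`-prefixed items `LatticeOnlyDepletes`, `DeepLatticeFloor`, `ModeIdentification` each give a
density threshold and an eventually-in-`m` set; take `ρ₁` the minimum of the three thresholds,
intersect the three eventual sets, and for `m` in the intersection and `0 < ρ < ρ₁` chain (after
zeta-reduction of the common `let` prefix)

  `ENNReal.ofReal (c₀ · 4m³) ≤ liminf_c Λ(c) ≤ Λ(0) ≤ periodicCondensateNumber v (4m³) L`.

This is exactly the hypothesis of `SparseToFull v`, whose conclusion is the hypothesis of
`BoundaryTransferWeak v`, whose conclusion is the `v`-clause of `BoseEinsteinCondensation`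
(an `abbrev` of `Literature.MathematicalPhysics.QuantumManyBody.BoseGas.BoseEinsteinCondensation`).
No analytic content lives here.

References: Lieb–Seiringer–Solovej–Yngvason 2005, §1.2 (1.16)–(1.19) (the conjunct being
assembled); Kennedy–Lieb–Shastry 1988 (the anchor behind `DeepLatticeFloor`).
-/

namespace Summit.AtomisticToContinuum.BoseEinsteinCondensation.Theorems

open Filter

/-- **Item stmt-AtomisticToContinuum-12409** (`Assembly` of route `BECLatticeDepthHomotopy`,
exact route decl): given `hLOD : LatticeOnlyDepletes`, `hDLF : DeepLatticeFloor`,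
`hMI : ModeIdentification`, `hSF : SparseToFull` and `hBT : BoundaryTransferWeak`, the sub-problem
statement `BoseEinsteinCondensation` holds. Proof: for a repulsive finite-range `v`, intersect
the three eventually-in-`m` sets and take the minimum of the three density thresholds; the chained
inequality `ofReal (c₀ N) ≤ liminf Λ ≤ Λ 0 ≤ periodicCondensateNumber` is the hypothesis of
`hSF v hv`, whose conclusion feeds `hBT v hv`. Pure composition of the route's hypotheses.
[folklore] -/
theorem becLatticeDepthHomotopy_assembly_proof :
    Summit.AtomisticToContinuum.BoseEinsteinCondensation.Theses.BECLatticeDepthHomotopy.Assembly := by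
  unfold Theses.BECLatticeDepthHomotopy.Assembly
  intro hLOD hDLF hMI hSF hBT v hv
  refine hBT v hv (hSF v hv ?_)
  obtain ⟨ρa, ha, hA⟩ := hLOD v hv
  obtain ⟨ρb, c₀, hb, hc₀, hB⟩ := hDLF v hv
  obtain ⟨ρc, hc, hC⟩ := hMI v hv
  refine ⟨min ρa (min ρb ρc), c₀, lt_min ha (lt_min hb hc), hc₀, ?_⟩
  filter_upwards [hA, hB, hC] with m hA hB hC
  intro ρ hρ hρ₁
  have h1 := hA ρ hρ (lt_of_lt_of_le hρ₁ (min_le_left _ _))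
  have h2 := hB ρ hρ (lt_of_lt_of_le hρ₁ ((min_le_right _ _).trans (min_le_left _ _)))
  have h3 := hC ρ hρ (lt_of_lt_of_le hρ₁ ((min_le_right _ _).trans (min_le_right _ _)))
  dsimp only at h1 h2 h3
  exact le_trans h2 (le_trans h1 h3)

end Summit.AtomisticToContinuum.BoseEinsteinCondensation.Theorems
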